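import Summits.BirchSwinnertonDyer.Rank1Residual.Supersingular.KobayashiSqueezeReal
import Summits.BirchSwinnertonDyer.Rank1Residual.X2.KeyCongruenceInvariants
import Summits.BirchSwinnertonDyer.Rank1Residual.X1.MuPart
import Literature.NumberTheory.EllipticCurves.KatoRankBoundMultiplicativeProofs
import Summits.BirchSwinnertonDyer.BirchSwinnertonDyer.Theorems.ThetaPartnerAtTwoSignedMainConjectureCMTwoRankZeroLengthCurrency
import HarnessLib

/-!
# Crux `KobayashiLowerHalfSemistable` (route `SignedLowerHalves`, item 2 = stmt-BirchSwinnertonDyer-19000):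
# the μ-SPLIT of the typed Eisenstein half `KobayashiLowerDivisibility W p ε`

HONEST FRAMING (cell `bsd-ssimc`, line `birth` of the crux; prover seat bsd-line-slh-p2 gen 3): THEOREMS ONLY,
route-independent (this file does not import the Theses file); nothing here is a theorem about any curve; the crux
stays OPEN modulo the preprint engine (closer of record `…Theorems.KobayashiLowerHalfSemistable_of_tiersS_C3`);
BSD is not proved by any of this.

WHAT IS PROVED. `KobayashiLowerDivisibility W p ε` (`Supersingular/KobayashiMainConjecture.lean`) asks, for every
admissible `(κ, γ, f, ϖ, L⁺, L⁻, D)`, for `char X^ε = (g)` with `ι g = ϖ · ι(L^ε · h)`, `h ∈ Λ` — an INTEGRAL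
divisibility `L^ε ∣ g` in `Λ = ℤ_p⟦T⟧` up to the period ratio `ϖ`. At an odd good prime `p` with `ρ̄_{E,p}`
irreducible (automatic on class X6), `ord_p ϖ = 0` by the two PUBLISHED period comparisons
`realPeriodRat_eq_unit_mul_plusPeriod(_three)` (Greenberg–Vatsal 2000 Rem. 3.4 + Manin constant; tree theorem
`Rank1Residual.padicValRat_periodRatio_eq_zero`), and then the predicate SPLITS EXACTLY (§3,
`kobayashiLowerDivisibility_iff_dvd_C_pow_mul_and_mu_le`) into
* a RATIONAL part — `L^ε ∣ p^t · g` for some `t` (a divisibility in `Λ[1/p]`, the raw output of an Euler-system /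
  Eisenstein-congruence argument before any `μ`-information), and
* a `μ`-part — `μ(L^ε) ≤ μ(g)` for the same generator (Greenberg–Vatsal's `μ`, tree `X1.MuLambda.mu`; for `X^ε`
  finitely generated torsion — Kobayashi Thm. 1.2 — this is `μ(L_p^ε) ≤ μ(X^ε)`, §4
  `mu_kobayashiL_le_mu_of_kobayashiLowerDivisibility`),
because in the UFD `Λ` a divisibility `L ∣ p^t g` with `μ(L) ≤ μ(g)` is already `L ∣ g` (tree lemma
`X2.KeyCongruence.dvd_of_dvd_C_pow_mul_of_mu_le`; §1 `dvd_iff_exists_dvd_C_pow_mul_and_mu_le`). Consequences: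
(i) NECESSITY — any proof of the crux proves, for its sign `ε`, the `μ`-inequality `μ(L_p^ε) ≤ μ(char X^ε)`
(§3 `dvd_and_mu_le_of_kobayashiLowerDivisibility`); (ii) SUFFICIENCY modulo `μ` — an engine delivering the
Eisenstein divisibility only in `Λ ⊗ ℚ_p` closes the predicate at every pair where `μ(L_p^ε) = 0` for one sign
(§3 `kobayashiLowerDivisibility_of_dvd_C_pow_mul_of_mu_eq_zero`; `μ(L_p^±) = 0` is Pollack's Conjecture 6.3,
Duke Math. J. 118 (2003) p. 548 — OPEN class-wide, a finite `p`-adic computation per pair); (iii) the X6 readings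
(§5) discharge `good`/`irreducible` from `ClassX6`. The split is the kernel form of the seam between the
"rational" Beilinson–Flach/GU(3,1) divisibility and the separate `μ`-step (the cell's S5) in the announced
proof of Burungale–Skinner–Tian–Wan (arXiv:2409.01350) Thm. 1.3; it asserts nothing about that proof.

References: [Kobayashi2003] Conjecture (p. 2), Thm. 1.2, (3.6) (p. 7); [GreenbergVatsal2000] (1)–(2) p. 4 and §3
Rem. 3.4; [Washington1997] §7.1, §13.2; [Pollack2003] Def. 6.1, Conj. 6.3 (p. 548).
-/

set_option autoImplicit false
set_option linter.dupNamespace false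

noncomputable section

open scoped Classical MatrixGroups ModularForm

open CongruenceSubgroup WeierstrassCurve Literature.NumberTheory.EllipticCurves
  Literature.NumberTheory.EllipticCurves.ModularForms
  Literature.NumberTheory.EllipticCurves.Rank1Residual
  Literature.NumberTheory.EllipticCurves.Rank1Residual.Typed
  Literature.NumberTheory.EllipticCurves.Kobayashi2003 ZpExtension
  Summit.BirchSwinnertonDyer.Rank1Residual
  Summit.BirchSwinnertonDyer.Rank1Residual.Supersingular
  Summit.BirchSwinnertonDyer.Rank1Residual.X1

namespace Summit.BirchSwinnertonDyer.BirchSwinnertonDyer.Theorems.MuSplit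

/-! ### §1 Algebra in `Λ = ℤ_p⟦T⟧`: a rational divisibility with the right `μ`-inequality is integral -/

section Algebra

variable {p : ℕ} [Fact p.Prime]

/-- `μ` is monotone along divisibility of non-zero elements of `Λ`: `L ∣ g ≠ 0 ⇒ μ(L) ≤ μ(g)`
(`μ` is additive on non-zero elements, `X1.MuLambda.mu_mul`). [cite: GreenbergVatsal2000, p. 4, (1)–(2)] -/
theorem mu_le_mu_of_dvd {L g : IwasawaAlgebra p} (hg : g ≠ 0) (h : L ∣ g) : MuLambda.mu L ≤ MuLambda.mu g := by
  obtain ⟨k, rfl⟩ := h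
  exact MuLambda.mu_le_mu_mul (left_ne_zero_of_mul hg) (right_ne_zero_of_mul hg)

/-- **The `μ`-split of a divisibility in `Λ`.** For `g ≠ 0`: `L ∣ g` iff (`L ∣ p^t · g` for some `t`) and
`μ(L) ≤ μ(g)` — the reverse implication is the tree's `X2.KeyCongruence.dvd_of_dvd_C_pow_mul_of_mu_le`
(write `p^t g = L k`, compare `μ`: `μ(k) ≥ t`, so `p^t ∣ k`). [cite: GreenbergVatsal2000, p. 4 (after Thm. (1.2))]
[cite: Washington1997, §7.1] -/
theorem dvd_iff_exists_dvd_C_pow_mul_and_mu_le {L g : IwasawaAlgebra p} (hg : g ≠ 0) :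
    L ∣ g ↔ (∃ t : ℕ, L ∣ PowerSeries.C (p : ℤ_[p]) ^ t * g) ∧ MuLambda.mu L ≤ MuLambda.mu g :=
  ⟨fun h ↦ ⟨⟨0, by simpa using h⟩, mu_le_mu_of_dvd hg h⟩,
    fun h ↦ by
      obtain ⟨⟨t, ht⟩, hμ⟩ := h
      exact X2.KeyCongruence.dvd_of_dvd_C_pow_mul_of_mu_le hg t ht hμ⟩

/-- A divisibility `L ∣ p^t · g` with `μ(L) = 0` is integral: `L ∣ g` (no hypothesis on `g`; for `g ≠ 0` this is the
tree's `X2.KellerYinFreePartGap.dvd_of_dvd_C_pow_mul_of_mu_eq_zero`). [cite: Washington1997, §7.1] -/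
theorem dvd_of_dvd_C_pow_mul_of_mu_eq_zero' {L g : IwasawaAlgebra p} (hμ : MuLambda.mu L = 0)
    {t : ℕ} (h : L ∣ PowerSeries.C (p : ℤ_[p]) ^ t * g) : L ∣ g := by
  by_cases hg : g = 0
  · exact hg ▸ dvd_zero L
  · exact X2.KeyCongruence.dvd_of_dvd_C_pow_mul_of_mu_le hg t h (hμ ▸ Nat.zero_le _)

/-- `ι : Λ → ℚ_p⟦T⟧` and a unit period ratio: if `u ∈ ℤ_p^×` maps to `ϖ ∈ ℚ`, then
`ι g = ϖ · ι x ↔ g = C u · x` (`ι` is injective, `ι(C u) = C ϖ`). [cite: MazurTateTeitelbaum1986Invent, §I.12] -/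
theorem iota_eq_C_mul_iota_iff {ϖ : ℚ} (u : ℤ_[p]ˣ) (hu : ((u : ℤ_[p]) : ℚ_[p]) = (ϖ : ℚ_[p]))
    (g x : IwasawaAlgebra p) :
    iwasawaToPowerSeries p g = PowerSeries.C (ϖ : ℚ_[p]) * iwasawaToPowerSeries p x ↔
      g = PowerSeries.C (u : ℤ_[p]) * x := by
  obtain ⟨-, hι⟩ := span_C_units_mul_eq u x
  rw [hu] at hι
  constructor
  · intro h
    exact iwasawaToPowerSeries_injective p (h.trans hι.symm)
  · rintro rfl
    exact hι

end Algebra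

/-! ### §2 The generator of `char X^ε` is non-zero

A generator `g` of `char_Λ X^ε(E/ℚ_∞)` is non-zero — the tree's characteristic ideal is a `finprod` of powers of
height-one primes of the domain `Λ`, never `⊥` (`Module.charIdeal_ne_bot`); in particular the typed Eisenstein half
can never be met by `g = 0`, `h = 0`. This is the landed `SignedLengthDoors.ne_zero_of_charIdeal_eq_span`, reused
below (not restated). -/

/-! ### §3 The μ-split of `KobayashiLowerDivisibility W p ε` -/

section Split

variable (W : WeierstrassCurve ℚ) [W.IsElliptic] [W.IsGloballyMinimal] (p : ℕ) [Fact p.Prime]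

/-- **NECESSITY: the crux's predicate contains an integral divisibility AND a `μ`-inequality.** At an odd good prime
`p` with `ρ̄_{E,p}` irreducible, granted the two published period comparisons (`h5`, `h3`: `ord_p(Ω⁺_f/Ω_E) = 0`),
`KobayashiLowerDivisibility W p ε` gives, for every admissible `(κ, γ, f, ϖ, L⁺, L⁻, D)`: `char X^ε = (g)` with
`L^ε ∣ g` IN `Λ` and `μ(L^ε) ≤ μ(g)` (`g ≠ 0`). So any proof of the crux for the sign `ε` proves the `μ`-inequality
`μ(L_p^ε) ≤ μ(ξ^ε)`. [cite: Kobayashi2003, Conjecture (Main Conjecture) (p. 2)] [cite: GreenbergVatsal2000, p. 4 and §3 Remark 3.4] -/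
theorem dvd_and_mu_le_of_kobayashiLowerDivisibility
    (h5 : realPeriodRat_eq_unit_mul_plusPeriod) (h3 : realPeriodRat_eq_unit_mul_plusPeriod_three)
    (hp : p ≠ 2) (hgood : W.HasGoodReductionAtPrime p) (hirr : W.HasIrreducibleModPGaloisRep p)
    {ε : ℤˣ} (h : KobayashiLowerDivisibility W p ε) :
    ∀ (κ : ZpExtension ℚ p) (γ : Field.absoluteGaloisGroup ℚ),
      κ.IsCyclotomic → κ.IsTopGenerator γ → IsCyclotomicVariable p γ →
    ∀ [NeZero (W.conductorNorm ℤ)] (f : CuspForm (Gamma0 (W.conductorNorm ℤ)) 2),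
      IsNewformOf W f → ∀ (ϖ : ℚ), (ϖ : ℝ) * W.realPeriodRat = plusPeriod f →
    ∀ (Lplus Lminus : IwasawaAlgebra p), IsPollackPair f p Lplus Lminus →
    ∀ (D : SignedSelmerDualData W κ γ ε),
      ∃ g : IwasawaAlgebra p, D.charIdeal = Ideal.span {g} ∧ g ≠ 0 ∧
        kobayashiL ε Lplus Lminus ∣ g ∧ MuLambda.mu (kobayashiL ε Lplus Lminus) ≤ MuLambda.mu g := by
  intro κ γ hκ hγ hv _ f hf ϖ hϖ Lplus Lminus hPP D
  obtain ⟨g, k, hchar, hι⟩ := h κ γ hκ hγ hv f hf ϖ hϖ Lplus Lminus hPP D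
  have hg0 : g ≠ 0 := SignedLengthDoors.ne_zero_of_charIdeal_eq_span D hchar
  have hϖ0 : ϖ ≠ 0 := hf.periodRatio_ne_zero hϖ
  have hvϖ : padicValRat p ϖ = 0 := padicValRat_periodRatio_eq_zero h5 h3 W p hp hgood hirr f hf ϖ hϖ
  obtain ⟨u, hu⟩ := exists_units_coe_eq_ratCast hϖ0 hvϖ
  have hgeq : g = PowerSeries.C (u : ℤ_[p]) * (kobayashiL ε Lplus Lminus * k) :=
    (iota_eq_C_mul_iota_iff u hu g _).mp hι
  have hdvd : kobayashiL ε Lplus Lminus ∣ g := ⟨PowerSeries.C (u : ℤ_[p]) * k, by rw [hgeq]; ring⟩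
  exact ⟨g, hchar, hg0, hdvd, mu_le_mu_of_dvd hg0 hdvd⟩

/-- **SUFFICIENCY: a RATIONAL Eisenstein divisibility plus the `μ`-inequality IS the crux's predicate.** At an odd
good prime `p` with `ρ̄_{E,p}` irreducible, granted `h5`/`h3`: if for every admissible `(κ, γ, f, ϖ, L⁺, L⁻, D)` some
generator `g` of `char X^ε` has `L^ε ∣ p^t · g` for some `t` (divisibility in `Λ[1/p]`) and `μ(L^ε) ≤ μ(g)`, then
`KobayashiLowerDivisibility W p ε`: `L^ε ∣ g` in `Λ` (§1), and `ι g = ϖ · ι(L^ε · ϖ⁻¹ k)` with `ϖ⁻¹ ∈ ℤ_p`.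
[cite: Kobayashi2003, Conjecture (Main Conjecture) (p. 2)] [cite: GreenbergVatsal2000, p. 4 and §3 Remark 3.4] -/
theorem kobayashiLowerDivisibility_of_dvd_C_pow_mul_of_mu_le
    (h5 : realPeriodRat_eq_unit_mul_plusPeriod) (h3 : realPeriodRat_eq_unit_mul_plusPeriod_three)
    (hp : p ≠ 2) (hgood : W.HasGoodReductionAtPrime p) (hirr : W.HasIrreducibleModPGaloisRep p) (ε : ℤˣ)
    (hR : ∀ (κ : ZpExtension ℚ p) (γ : Field.absoluteGaloisGroup ℚ),
      κ.IsCyclotomic → κ.IsTopGenerator γ → IsCyclotomicVariable p γ →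
      ∀ [NeZero (W.conductorNorm ℤ)] (f : CuspForm (Gamma0 (W.conductorNorm ℤ)) 2),
        IsNewformOf W f → ∀ (ϖ : ℚ), (ϖ : ℝ) * W.realPeriodRat = plusPeriod f →
      ∀ (Lplus Lminus : IwasawaAlgebra p), IsPollackPair f p Lplus Lminus →
      ∀ (D : SignedSelmerDualData W κ γ ε),
        ∃ (g : IwasawaAlgebra p) (t : ℕ), D.charIdeal = Ideal.span {g} ∧
          kobayashiL ε Lplus Lminus ∣ PowerSeries.C (p : ℤ_[p]) ^ t * g ∧
          MuLambda.mu (kobayashiL ε Lplus Lminus) ≤ MuLambda.mu g) :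
    KobayashiLowerDivisibility W p ε := by
  intro κ γ hκ hγ hv _ f hf ϖ hϖ Lplus Lminus hPP D
  obtain ⟨g, t, hchar, hdvd, hμ⟩ := hR κ γ hκ hγ hv f hf ϖ hϖ Lplus Lminus hPP D
  have hg0 : g ≠ 0 := SignedLengthDoors.ne_zero_of_charIdeal_eq_span D hchar
  obtain ⟨k, hk⟩ : kobayashiL ε Lplus Lminus ∣ g :=
    X2.KeyCongruence.dvd_of_dvd_C_pow_mul_of_mu_le hg0 t hdvd hμ
  have hϖ0 : ϖ ≠ 0 := hf.periodRatio_ne_zero hϖ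
  have hvϖ : padicValRat p ϖ = 0 := padicValRat_periodRatio_eq_zero h5 h3 W p hp hgood hirr f hf ϖ hϖ
  obtain ⟨u, hu⟩ := exists_units_coe_eq_ratCast hϖ0 hvϖ
  refine ⟨g, PowerSeries.C ((u⁻¹ : ℤ_[p]ˣ) : ℤ_[p]) * k, hchar, ?_⟩
  refine (iota_eq_C_mul_iota_iff u hu g _).mpr ?_
  calc g = kobayashiL ε Lplus Lminus * k := hk
    _ = (PowerSeries.C (u : ℤ_[p]) * PowerSeries.C ((u⁻¹ : ℤ_[p]ˣ) : ℤ_[p])) *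
          (kobayashiL ε Lplus Lminus * k) := by
        rw [← map_mul, Units.mul_inv, map_one, one_mul]
    _ = PowerSeries.C (u : ℤ_[p]) * (kobayashiL ε Lplus Lminus * (PowerSeries.C ((u⁻¹ : ℤ_[p]ˣ) : ℤ_[p]) * k)) := by
        ring

/-- **THE μ-SPLIT (exact).** At an odd good prime `p` with `ρ̄_{E,p}` irreducible, granted the published period
comparisons `h5`/`h3`: `KobayashiLowerDivisibility W p ε` ⟺ for every admissible `(κ, γ, f, ϖ, L⁺, L⁻, D)` there are
a generator `g` of `char X^ε` and `t ∈ ℕ` with `L^ε ∣ p^t · g` (RATIONAL part) and `μ(L^ε) ≤ μ(g)` (`μ`-part).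
[cite: Kobayashi2003, Conjecture (Main Conjecture) (p. 2)] [cite: GreenbergVatsal2000, p. 4 and §3 Remark 3.4]
[cite: Washington1997, §7.1 and §13.2] -/
theorem kobayashiLowerDivisibility_iff_dvd_C_pow_mul_and_mu_le
    (h5 : realPeriodRat_eq_unit_mul_plusPeriod) (h3 : realPeriodRat_eq_unit_mul_plusPeriod_three)
    (hp : p ≠ 2) (hgood : W.HasGoodReductionAtPrime p) (hirr : W.HasIrreducibleModPGaloisRep p) (ε : ℤˣ) :
    KobayashiLowerDivisibility W p ε ↔
    ∀ (κ : ZpExtension ℚ p) (γ : Field.absoluteGaloisGroup ℚ),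
      κ.IsCyclotomic → κ.IsTopGenerator γ → IsCyclotomicVariable p γ →
      ∀ [NeZero (W.conductorNorm ℤ)] (f : CuspForm (Gamma0 (W.conductorNorm ℤ)) 2),
        IsNewformOf W f → ∀ (ϖ : ℚ), (ϖ : ℝ) * W.realPeriodRat = plusPeriod f →
      ∀ (Lplus Lminus : IwasawaAlgebra p), IsPollackPair f p Lplus Lminus →
      ∀ (D : SignedSelmerDualData W κ γ ε),
        ∃ (g : IwasawaAlgebra p) (t : ℕ), D.charIdeal = Ideal.span {g} ∧
          kobayashiL ε Lplus Lminus ∣ PowerSeries.C (p : ℤ_[p]) ^ t * g ∧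
          MuLambda.mu (kobayashiL ε Lplus Lminus) ≤ MuLambda.mu g := by
  refine ⟨fun h κ γ hκ hγ hv _ f hf ϖ hϖ Lplus Lminus hPP D ↦ ?_,
    kobayashiLowerDivisibility_of_dvd_C_pow_mul_of_mu_le W p h5 h3 hp hgood hirr ε⟩
  obtain ⟨g, hchar, -, hdvd, hμ⟩ :=
    dvd_and_mu_le_of_kobayashiLowerDivisibility W p h5 h3 hp hgood hirr h κ γ hκ hγ hv f hf ϖ hϖ Lplus Lminus hPP D
  exact ⟨g, 0, hchar, by simpa using hdvd, hμ⟩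

/-- **SUFFICIENCY MODULO `μ(L_p^ε) = 0`.** If an engine delivers the Eisenstein divisibility only RATIONALLY
(`L^ε ∣ p^t · g`, i.e. in `Λ ⊗ ℚ_p`) and `μ(L_p^ε) = 0` (Pollack's Conjecture 6.3 for the sign `ε`; per pair a finite
`p`-adic computation on Pollack's `L_p^ε`), the `μ`-inequality is free and `KobayashiLowerDivisibility W p ε` follows —
at an odd good `p` with `ρ̄_{E,p}` irreducible, granted `h5`/`h3`. [cite: Pollack2003, Conjecture 6.3 (p. 548)]
[cite: Kobayashi2003, Conjecture (Main Conjecture) (p. 2)] [cite: GreenbergVatsal2000, §3 Remark 3.4] -/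
theorem kobayashiLowerDivisibility_of_dvd_C_pow_mul_of_mu_eq_zero
    (h5 : realPeriodRat_eq_unit_mul_plusPeriod) (h3 : realPeriodRat_eq_unit_mul_plusPeriod_three)
    (hp : p ≠ 2) (hgood : W.HasGoodReductionAtPrime p) (hirr : W.HasIrreducibleModPGaloisRep p) (ε : ℤˣ)
    (hR : ∀ (κ : ZpExtension ℚ p) (γ : Field.absoluteGaloisGroup ℚ),
      κ.IsCyclotomic → κ.IsTopGenerator γ → IsCyclotomicVariable p γ →
      ∀ [NeZero (W.conductorNorm ℤ)] (f : CuspForm (Gamma0 (W.conductorNorm ℤ)) 2),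
        IsNewformOf W f → ∀ (ϖ : ℚ), (ϖ : ℝ) * W.realPeriodRat = plusPeriod f →
      ∀ (Lplus Lminus : IwasawaAlgebra p), IsPollackPair f p Lplus Lminus →
      ∀ (D : SignedSelmerDualData W κ γ ε),
        MuLambda.mu (kobayashiL ε Lplus Lminus) = 0 ∧
        ∃ (g : IwasawaAlgebra p) (t : ℕ), D.charIdeal = Ideal.span {g} ∧
          kobayashiL ε Lplus Lminus ∣ PowerSeries.C (p : ℤ_[p]) ^ t * g) :
    KobayashiLowerDivisibility W p ε := by
  refine kobayashiLowerDivisibility_of_dvd_C_pow_mul_of_mu_le W p h5 h3 hp hgood hirr ε ?_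
  intro κ γ hκ hγ hv _ f hf ϖ hϖ Lplus Lminus hPP D
  obtain ⟨hμ0, g, t, hchar, hdvd⟩ := hR κ γ hκ hγ hv f hf ϖ hϖ Lplus Lminus hPP D
  exact ⟨g, t, hchar, hdvd, hμ0 ▸ Nat.zero_le _⟩

end Split

/-! ### §4 The `μ`-part read on the MODULE: `μ(L_p^ε) ≤ μ(X^ε)` (granted Kobayashi Thm. 1.2) -/

section ModuleMu

variable (W : WeierstrassCurve ℚ) [W.IsElliptic] [W.IsGloballyMinimal] (p : ℕ) [Fact p.Prime]

/-- **The crux forces `μ(L_p^ε) ≤ μ^ε := μ(X^ε(E/ℚ_∞))` for its sign.** At an odd good prime `p` with `a_p = 0` and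
`ρ̄_{E,p}` irreducible, granted Kobayashi Thm. 1.2 BY NAME (`h12`: `X^ε` finitely generated `Λ`-torsion, so that
`μ(g) = μ(X^ε)` for `char X^ε = (g)`, tree theorem `X1.MuPart.mu_generator_eq_muInvariant`) and the period
comparisons `h5`/`h3`: `KobayashiLowerDivisibility W p ε` implies `μ(L^ε) ≤ D.mu` for every admissible datum — the
`μ`-half "`μ_an^ε ≤ μ_alg^ε`" of Kobayashi's main conjecture, stated with the module invariant of Thm. 1.4.
[cite: Kobayashi2003, Thm. 1.2 and Thm. 1.4 (the invariants) and Conjecture (p. 2)] [cite: Washington1997, §13.2]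
[cite: GreenbergVatsal2000, p. 2, (1)–(2)] -/
theorem mu_kobayashiL_le_mu_of_kobayashiLowerDivisibility
    (h12 : Kobayashi2003.thm12_signedSelmerDual_finite_torsion)
    (h5 : realPeriodRat_eq_unit_mul_plusPeriod) (h3 : realPeriodRat_eq_unit_mul_plusPeriod_three)
    (hp : p ≠ 2) (hgood : W.HasGoodReductionAtPrime p) (hap : W.frobeniusTrace p = 0)
    (hirr : W.HasIrreducibleModPGaloisRep p) {ε : ℤˣ} (h : KobayashiLowerDivisibility W p ε) :
    ∀ (κ : ZpExtension ℚ p) (γ : Field.absoluteGaloisGroup ℚ),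
      κ.IsCyclotomic → κ.IsTopGenerator γ → IsCyclotomicVariable p γ →
    ∀ [NeZero (W.conductorNorm ℤ)] (f : CuspForm (Gamma0 (W.conductorNorm ℤ)) 2),
      IsNewformOf W f → ∀ (ϖ : ℚ), (ϖ : ℝ) * W.realPeriodRat = plusPeriod f →
    ∀ (Lplus Lminus : IwasawaAlgebra p), IsPollackPair f p Lplus Lminus →
    ∀ (D : SignedSelmerDualData W κ γ ε), MuLambda.mu (kobayashiL ε Lplus Lminus) ≤ D.mu := by
  intro κ γ hκ hγ hv _ f hf ϖ hϖ Lplus Lminus hPP D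
  obtain ⟨g, hchar, hg0, -, hμ⟩ :=
    dvd_and_mu_le_of_kobayashiLowerDivisibility W p h5 h3 hp hgood hirr h κ γ hκ hγ hv f hf ϖ hϖ Lplus Lminus hPP D
  obtain ⟨hfin, htor⟩ := h12 W p hp hgood hap κ γ hκ hγ ε D
  haveI := hfin
  have hgen : MuLambda.mu g = muInvariant p D.X := MuPart.mu_generator_eq_muInvariant D.X htor hg0 hchar
  change MuLambda.mu (kobayashiL ε Lplus Lminus) ≤ muInvariant p D.X
  exact hgen ▸ hμ

end ModuleMu

/-! ### §5 X6 readings (the crux's class: semistable, good supersingular, `p ≥ 5 ∨ a_3 = 0`) -/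

section X6

variable (W : WeierstrassCurve ℚ) [W.IsElliptic] [W.IsGloballyMinimal] (p : ℕ) [Fact p.Prime]

/-- **μ-split of the crux's predicate on class X6** (`good`, `irreducible` automatic: `ClassX6.irr`): at an odd `p`
with `ClassX6 W p`, granted `h5`/`h3`, `KobayashiLowerDivisibility W p ε` ⟺ (RATIONAL part ∧ `μ`-part) for every
admissible datum. [cite: Kobayashi2003, Conjecture (Main Conjecture) (p. 2)] [cite: GreenbergVatsal2000, §3 Remark 3.4] -/
theorem X6.kobayashiLowerDivisibility_iff_dvd_C_pow_mul_and_mu_le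
    (h5 : realPeriodRat_eq_unit_mul_plusPeriod) (h3 : realPeriodRat_eq_unit_mul_plusPeriod_three)
    (hp : p ≠ 2) (hX : ClassX6 W p) (ε : ℤˣ) :
    KobayashiLowerDivisibility W p ε ↔
    ∀ (κ : ZpExtension ℚ p) (γ : Field.absoluteGaloisGroup ℚ),
      κ.IsCyclotomic → κ.IsTopGenerator γ → IsCyclotomicVariable p γ →
      ∀ [NeZero (W.conductorNorm ℤ)] (f : CuspForm (Gamma0 (W.conductorNorm ℤ)) 2),
        IsNewformOf W f → ∀ (ϖ : ℚ), (ϖ : ℝ) * W.realPeriodRat = plusPeriod f →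
      ∀ (Lplus Lminus : IwasawaAlgebra p), IsPollackPair f p Lplus Lminus →
      ∀ (D : SignedSelmerDualData W κ γ ε),
        ∃ (g : IwasawaAlgebra p) (t : ℕ), D.charIdeal = Ideal.span {g} ∧
          kobayashiL ε Lplus Lminus ∣ PowerSeries.C (p : ℤ_[p]) ^ t * g ∧
          MuLambda.mu (kobayashiL ε Lplus Lminus) ≤ MuLambda.mu g :=
  MuSplit.kobayashiLowerDivisibility_iff_dvd_C_pow_mul_and_mu_le W p h5 h3 hp hX.1.1 (ClassX6.irr W p hp hX) ε

/-- **The crux's conclusion `∃ ε, KobayashiLowerDivisibility W p ε` at an X6 pair from: a RATIONAL Eisenstein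
divisibility for one sign `ε` together with the `μ`-inequality for that sign** (granted `h5`/`h3`). This is the
per-pair shape a reshaped line `birth` = (engine in `Λ ⊗ ℚ_p`) + (`μ`-step) has to deliver.
[cite: Kobayashi2003, Conjecture (Main Conjecture) (p. 2)] [cite: GreenbergVatsal2000, §3 Remark 3.4] -/
theorem X6.exists_kobayashiLowerDivisibility_of_dvd_C_pow_mul_of_mu_le
    (h5 : realPeriodRat_eq_unit_mul_plusPeriod) (h3 : realPeriodRat_eq_unit_mul_plusPeriod_three)
    (hp : p ≠ 2) (hX : ClassX6 W p) (ε : ℤˣ)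
    (hR : ∀ (κ : ZpExtension ℚ p) (γ : Field.absoluteGaloisGroup ℚ),
      κ.IsCyclotomic → κ.IsTopGenerator γ → IsCyclotomicVariable p γ →
      ∀ [NeZero (W.conductorNorm ℤ)] (f : CuspForm (Gamma0 (W.conductorNorm ℤ)) 2),
        IsNewformOf W f → ∀ (ϖ : ℚ), (ϖ : ℝ) * W.realPeriodRat = plusPeriod f →
      ∀ (Lplus Lminus : IwasawaAlgebra p), IsPollackPair f p Lplus Lminus →
      ∀ (D : SignedSelmerDualData W κ γ ε),
        ∃ (g : IwasawaAlgebra p) (t : ℕ), D.charIdeal = Ideal.span {g} ∧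
          kobayashiL ε Lplus Lminus ∣ PowerSeries.C (p : ℤ_[p]) ^ t * g ∧
          MuLambda.mu (kobayashiL ε Lplus Lminus) ≤ MuLambda.mu g) :
    ∃ ε : ℤˣ, KobayashiLowerDivisibility W p ε :=
  ⟨ε, MuSplit.kobayashiLowerDivisibility_of_dvd_C_pow_mul_of_mu_le W p h5 h3 hp hX.1.1 (ClassX6.irr W p hp hX) ε hR⟩

/-- **On X6 the crux forces `μ(L_p^ε) ≤ μ(X^ε)` for its sign** (Kobayashi Thm. 1.2 `h12` by name; `a_p = 0` and
irreducibility automatic on X6 at odd `p`). [cite: Kobayashi2003, Thm. 1.2, Thm. 1.4 and Conjecture (p. 2)]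
[cite: GreenbergVatsal2000, §3 Remark 3.4] -/
theorem X6.mu_kobayashiL_le_mu_of_kobayashiLowerDivisibility
    (h12 : Kobayashi2003.thm12_signedSelmerDual_finite_torsion)
    (h5 : realPeriodRat_eq_unit_mul_plusPeriod) (h3 : realPeriodRat_eq_unit_mul_plusPeriod_three)
    (hp : p ≠ 2) (hX : ClassX6 W p) {ε : ℤˣ} (h : KobayashiLowerDivisibility W p ε) :
    ∀ (κ : ZpExtension ℚ p) (γ : Field.absoluteGaloisGroup ℚ),
      κ.IsCyclotomic → κ.IsTopGenerator γ → IsCyclotomicVariable p γ →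
    ∀ [NeZero (W.conductorNorm ℤ)] (f : CuspForm (Gamma0 (W.conductorNorm ℤ)) 2),
      IsNewformOf W f → ∀ (ϖ : ℚ), (ϖ : ℝ) * W.realPeriodRat = plusPeriod f →
    ∀ (Lplus Lminus : IwasawaAlgebra p), IsPollackPair f p Lplus Lminus →
    ∀ (D : SignedSelmerDualData W κ γ ε), MuLambda.mu (kobayashiL ε Lplus Lminus) ≤ D.mu :=
  MuSplit.mu_kobayashiL_le_mu_of_kobayashiLowerDivisibility W p h12 h5 h3 hp hX.1.1
    (ClassX6.frobeniusTrace_eq_zero W p hp hX) (ClassX6.irr W p hp hX) h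

end X6

/-! ### §6 A both-signs RATIONAL engine plus ONE vanishing analytic `μ` gives the crux's `∃ ε` (appended, gen 3) -/

section OneSign

variable (W : WeierstrassCurve ℚ) [W.IsElliptic] [W.IsGloballyMinimal] (p : ℕ) [Fact p.Prime]

/-- **The crux's `∃ ε` from a both-signs RATIONAL Eisenstein divisibility and the vanishing of ONE analytic `μ`.**
At an odd good prime `p` with `ρ̄_{E,p}` irreducible, granted `h5`/`h3`: if for EVERY sign `ε` the Eisenstein divisibility
holds in `Λ ⊗ ℚ_p` (`L^ε ∣ p^t · g`, `char X^ε = (g)` — the shape a Beilinson–Flach / GU(3,1) argument delivers for both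
signs at once), and for SOME sign `ε ∈ ℤˣ = {±1}` (i.e. `μ(L_p^+) = 0 ∨ μ(L_p^−) = 0`) one has `μ(L^ε) = 0` for (the unique)
Pollack pair — `hμ`, quantified over the admissible data exactly like the predicate — then `∃ ε, KobayashiLowerDivisibility W p ε`.
This is the precise sense in which the existential sign of crux 2 would ABSORB the `μ`-step: it needs
`μ(L_p^+) = 0 ∨ μ(L_p^−) = 0`, which is Pollack's Conjecture 6.3 weakened to one sign — OPEN class-wide (Pollack 2003 p. 548;
Pollack–Weston 2011 Rem. 4.2 (1)), a finite `p`-adic computation per pair. [cite: Pollack2003, Conjecture 6.3 (p. 548)]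
[cite: Kobayashi2003, Conjecture (Main Conjecture) (p. 2)] [cite: GreenbergVatsal2000, §3 Remark 3.4] -/
theorem exists_kobayashiLowerDivisibility_of_forall_dvd_C_pow_mul_of_mu_eq_zero_or
    (h5 : realPeriodRat_eq_unit_mul_plusPeriod) (h3 : realPeriodRat_eq_unit_mul_plusPeriod_three)
    (hp : p ≠ 2) (hgood : W.HasGoodReductionAtPrime p) (hirr : W.HasIrreducibleModPGaloisRep p)
    (hR : ∀ (ε : ℤˣ) (κ : ZpExtension ℚ p) (γ : Field.absoluteGaloisGroup ℚ),
      κ.IsCyclotomic → κ.IsTopGenerator γ → IsCyclotomicVariable p γ →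
      ∀ [NeZero (W.conductorNorm ℤ)] (f : CuspForm (Gamma0 (W.conductorNorm ℤ)) 2),
        IsNewformOf W f → ∀ (ϖ : ℚ), (ϖ : ℝ) * W.realPeriodRat = plusPeriod f →
      ∀ (Lplus Lminus : IwasawaAlgebra p), IsPollackPair f p Lplus Lminus →
      ∀ (D : SignedSelmerDualData W κ γ ε),
        ∃ (g : IwasawaAlgebra p) (t : ℕ), D.charIdeal = Ideal.span {g} ∧
          kobayashiL ε Lplus Lminus ∣ PowerSeries.C (p : ℤ_[p]) ^ t * g)
    (hμ : ∃ ε : ℤˣ, ∀ (κ : ZpExtension ℚ p) (γ : Field.absoluteGaloisGroup ℚ),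
      κ.IsCyclotomic → κ.IsTopGenerator γ → IsCyclotomicVariable p γ →
      ∀ [NeZero (W.conductorNorm ℤ)] (f : CuspForm (Gamma0 (W.conductorNorm ℤ)) 2),
        IsNewformOf W f → ∀ (ϖ : ℚ), (ϖ : ℝ) * W.realPeriodRat = plusPeriod f →
      ∀ (Lplus Lminus : IwasawaAlgebra p), IsPollackPair f p Lplus Lminus →
        MuLambda.mu (kobayashiL ε Lplus Lminus) = 0) :
    ∃ ε : ℤˣ, KobayashiLowerDivisibility W p ε := by
  obtain ⟨ε, hε⟩ := hμ
  refine ⟨ε, kobayashiLowerDivisibility_of_dvd_C_pow_mul_of_mu_eq_zero W p h5 h3 hp hgood hirr ε ?_⟩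
  intro κ γ hκ hγ hv _ f hf ϖ hϖ Lplus Lminus hPP D
  exact ⟨hε κ γ hκ hγ hv f hf ϖ hϖ Lplus Lminus hPP, hR ε κ γ hκ hγ hv f hf ϖ hϖ Lplus Lminus hPP D⟩

/-- **X6 reading of §6**: on the crux's class (`good`, `irreducible` automatic), both-signs rational engine + one vanishing
analytic `μ` ⇒ `∃ ε, KobayashiLowerDivisibility W p ε`. [cite: Pollack2003, Conjecture 6.3 (p. 548)]
[cite: Kobayashi2003, Conjecture (Main Conjecture) (p. 2)] -/
theorem X6.exists_kobayashiLowerDivisibility_of_forall_dvd_C_pow_mul_of_mu_eq_zero_or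
    (h5 : realPeriodRat_eq_unit_mul_plusPeriod) (h3 : realPeriodRat_eq_unit_mul_plusPeriod_three)
    (hp : p ≠ 2) (hX : ClassX6 W p)
    (hR : ∀ (ε : ℤˣ) (κ : ZpExtension ℚ p) (γ : Field.absoluteGaloisGroup ℚ),
      κ.IsCyclotomic → κ.IsTopGenerator γ → IsCyclotomicVariable p γ →
      ∀ [NeZero (W.conductorNorm ℤ)] (f : CuspForm (Gamma0 (W.conductorNorm ℤ)) 2),
        IsNewformOf W f → ∀ (ϖ : ℚ), (ϖ : ℝ) * W.realPeriodRat = plusPeriod f →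
      ∀ (Lplus Lminus : IwasawaAlgebra p), IsPollackPair f p Lplus Lminus →
      ∀ (D : SignedSelmerDualData W κ γ ε),
        ∃ (g : IwasawaAlgebra p) (t : ℕ), D.charIdeal = Ideal.span {g} ∧
          kobayashiL ε Lplus Lminus ∣ PowerSeries.C (p : ℤ_[p]) ^ t * g)
    (hμ : ∃ ε : ℤˣ, ∀ (κ : ZpExtension ℚ p) (γ : Field.absoluteGaloisGroup ℚ),
      κ.IsCyclotomic → κ.IsTopGenerator γ → IsCyclotomicVariable p γ →
      ∀ [NeZero (W.conductorNorm ℤ)] (f : CuspForm (Gamma0 (W.conductorNorm ℤ)) 2),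
        IsNewformOf W f → ∀ (ϖ : ℚ), (ϖ : ℝ) * W.realPeriodRat = plusPeriod f →
      ∀ (Lplus Lminus : IwasawaAlgebra p), IsPollackPair f p Lplus Lminus →
        MuLambda.mu (kobayashiL ε Lplus Lminus) = 0) :
    ∃ ε : ℤˣ, KobayashiLowerDivisibility W p ε :=
  MuSplit.exists_kobayashiLowerDivisibility_of_forall_dvd_C_pow_mul_of_mu_eq_zero_or W p h5 h3 hp hX.1.1
    (ClassX6.irr W p hp hX) hR hμ

end OneSign

end Summit.BirchSwinnertonDyer.BirchSwinnertonDyer.Theorems.MuSplit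

end
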